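/-
Copyright (c) 2026 the pub-hodgecm-mathlib formalisation cell (harness21).  Prover seat hodgecm-mathlib-K2E5-p17 (g8), Track B «K2-LIT»,
#184♮ = hLiu418 = `stmt-HodgeConjecture-24832`; ROAD Φ row G6-arch (A∞), σ20 per-K-type MEROMORPHIC PACKAGE (LEAD F0P6-plan (g14) OWNER WORD σ20 2026-09-04T14:12:13Z;
K2E5-plan (g7) TABLE #3 (u2)(c1) 15:10:57Z; desk K2Liu-p11 (g3)).  THEOREMS ONLY (no `def`, no `instance`, no named-fact hypothesis, no `sorry`).
-/
import Summits.HodgeConjecture.HodgeConjecture.Theorems.K2LiuLadderContinuationPackage   -- ★ (H4-gen) (⊇ ★ (H1) `K2LiuLadderIntertwinerScalars`): path scalars, local bounds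
import HarnessLib

/-!
# Crux `HLiu418`, G6-arch (A∞), σ20: THE MEROMORPHIC PACKAGE OF A `K_w`-TYPE ALONG THE S2-C PATHS HAS NO NEW POLES —
# `P_{k,l} = P_anchor` (`∅` for the odd class, `{½}` for the even class), `G_{k,l} = G_anchor · ∏ b_i∕a_i` holomorphic on `{0 < re}`

Cell `hodgecm-mathlib`, crux item hLiu418 = `stmt-HodgeConjecture-24832` (helper lane `--supports … --as helper`, count-neutral).

σ20 (LEAD, verbatim gist): for each `K_w`-type `(k,l)` of the compact picture of `I_w(s)` on `U(2,2)`, `∃ P_{k,l} : Finset ℂ` EXPLICIT (⊆ dead-arrow abscissae of the live path to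
`(k,l)` ∪ `{½}` for the even class) and `∃ G` holomorphic on `{0 < re}` with `G = ∏_{p∈P_{k,l}}(s − p)·c_{k,l}(s)` on `{½ < re}`, plus the local growth letter; `P := ⋃ P_{k,l}`.
THE LADDER (★ (H1) `scalar_path`, ★ (H2-alg) `rung_step`, (H2-an) swap binders): along a path of live arrows `x₀ → ⋯ → x_n` from a scalar ANCHOR type, the scalar of `M*_w(s)` obeys
`c_n(s) = c₀(s)·∏_{i<n} b_i(s)∕a_i(s)` on the convergence region, `a_i` = SOURCE arrow scalar at parameter `s` (★ S2-T `K2LiuU22KTypeTransitions` with ★ dictionary `p(s) = s+1+κ∕2`,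
`q(s) = s+1−κ∕2`: `q+λ₁` for `+e₁`, `p−λ₂` for `−e₂`, `(k∕(k+1))(q+λ₂−1)` for `+e₂`, `(k∕(k+1))(p−λ₁−1)` for `−e₁`), `b_i` = TARGET arrow scalar (parameter `−s`; affine, entire).
THE FINDING (census 2026-09-04T15:12:47Z, numbers not taste).  The S2-C paths (★ `K2LiuU22KTypePaths`: region 𝐀 from the anchor `(0, c₁+1)` = `+e₁` along row `c₁+1` then `∓e₂`;
region 𝐃 from `(0, c₁)` = `−e₂` down then `±e₁`; `c₁ = (κ−1)∕2`) only ever use arrows whose source scalar is LIVE ON THE WHOLE HALF-PLANE `{0 < re s}`: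
`+e₁` at `λ₁ ≥ κ∕2 − 1` (`q+λ₁ = s + (1 − κ∕2 + λ₁)`, real part `> 0`), `−e₂` at `λ₂ ≤ κ∕2 + 1`, `+e₂` at `λ₂ ≥ κ∕2` with `k ≥ 1`, `−e₁` at `λ₁ ≤ κ∕2` with `k ≥ 1` — the regions'
defining inequalities (`λ₁ ≥ c₁ = κ∕2 − ½`, `λ₂ ≤ c₁ + 1 = κ∕2 + ½`, …) imply these with room to spare.  HENCE (★ (H1) `differentiableOn_path_scalar` with `a_i ≠ 0` on all of `U`):
**the package of `(k,l)` is the ANCHOR's: `P_{k,l} = P₀`, `G_{k,l} := G₀·∏ b_i∕a_i`** — no dead-arrow abscissa enters `{0 < re}`, σ20's union is `P ⊆ {½}`, and #41's `P ⊆ {½}` is safe on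
the archimedean ladder.  (The anchor package `(P₀, G₀)` — `P₀ = ∅` for odd `κ`-class, `{½}` for even, ★ `K2LiuArchIntertwiningScalarPole` `(2s−1)c_k = R_k` ∕ ★ (L2) — and the rung
relations enter BY VALUE.)
* §1 **`exists_package_of_live_path`** — generic: anchor package `(P₀, G₀)` on `U`, rung relation on `conv`, `a_i, b_i` holomorphic on `U`, `a_i ≠ 0` on `U` ⇒ `∃ G` holomorphic on `U`
  with `G = ∏_{q∈P₀}(z − q)·c_n` on `conv` (SAME `P₀`); `exists_package_of_live_path_re_pos` (+ σ20's local growth letter, ★ `exists_local_bound_re_pos`).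
* §2 the four U(2,2) source scalars as functions of `s`: holomorphic, and NON-VANISHING on `{0 < re}` under the label inequalities (`re` bookkeeping only).
* §3 **`exists_package_of_regionPath`** — a path each of whose source scalars has one of the four shapes with its inequality ⇒ the package with `P = P₀` on `U = {0 < re}`,
  `conv = {½ < re}`, with the growth letter.
Sources: [LeeZhu1998, §5 (5.3), Prop. 5.4]; [Shimura1997, §16.4]; [KudlaRallis1994, §1 (citation)].
HONEST LABEL.  Count-neutral helper; `HC_CM` is proved only modulo the 7 printed citations (2 remaining named inputs: hLiu418 = `stmt-HodgeConjecture-24832`,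
h413 = `stmt-HodgeConjecture-24833`) until rung 0 closes.
-/

set_option autoImplicit false
set_option linter.dupNamespace false -- the mandated namespace repeats `HodgeConjecture.HodgeConjecture`

noncomputable section

namespace Summit.HodgeConjecture.HodgeConjecture.Cruxes.HLiu418.K2LiuArchLadderMeromorphicPackage

open Complex Set
open scoped BigOperators
open Summit.HodgeConjecture.HodgeConjecture.Cruxes.HLiu418.K2LiuLadderIntertwinerScalars
open Summit.HodgeConjecture.HodgeConjecture.Cruxes.HLiu418.K2LiuLadderContinuationPackage

/-! ## §1 The package along a path of arrows LIVE on the whole domain: no new poles -/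

section LivePath

/-- **THE PACKAGE ALONG A LIVE PATH HAS THE ANCHOR'S POLE SET.**  Anchor package `(P₀, G₀)` on `U` (`G₀` holomorphic, `G₀ = ∏_{q∈P₀}(z−q)·c₀` on `conv`), rung relation
`c_n = c₀·∏ b_i∕a_i` on `conv`, arrow scalars `a_i, b_i` holomorphic on `U` with the source scalars `a_i` NON-VANISHING ON `U` ⇒ `G := G₀·∏ b_i∕a_i` is holomorphic on `U` and
`G = ∏_{q∈P₀}(z−q)·c_n` on `conv` — the package of the end type with the SAME `P₀`. [cite: LeeZhu1998, §5 (5.3)] [cite: Shimura1997, §16.4] -/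
theorem exists_package_of_live_path (U : Set ℂ) (conv : ℂ → Prop) (n : ℕ) (c a b : ℕ → ℂ → ℂ) (P₀ : Finset ℂ) (G₀ : ℂ → ℂ)
    (hpath : ∀ z, conv z → c n z = c 0 z * ∏ i ∈ Finset.range n, (b i z / a i z))
    (hG₀ : DifferentiableOn ℂ G₀ U) (hG₀eq : ∀ z, conv z → G₀ z = (∏ q ∈ P₀, (z - q)) * c 0 z)
    (ha : ∀ i < n, DifferentiableOn ℂ (a i) U) (hb : ∀ i < n, DifferentiableOn ℂ (b i) U) (ha0 : ∀ i < n, ∀ z ∈ U, a i z ≠ 0) :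
    ∃ G : ℂ → ℂ, DifferentiableOn ℂ G U ∧ ∀ z, conv z → G z = (∏ q ∈ P₀, (z - q)) * c n z := by
  refine ⟨fun z => G₀ z * ∏ i ∈ Finset.range n, (b i z / a i z), differentiableOn_path_scalar U n G₀ a b hG₀ ha hb ha0, fun z hz => ?_⟩
  show G₀ z * ∏ i ∈ Finset.range n, (b i z / a i z) = (∏ q ∈ P₀, (z - q)) * c n z
  rw [hG₀eq z hz, hpath z hz, mul_assoc]

/-- the same on `U := {0 < re}`, `conv := {½ < re}`, WITH σ20's local growth letter (★ (H4-gen) `exists_local_bound_re_pos`). [cite: LeeZhu1998, §5 (5.3)] [cite: Shimura1997, §16.4] -/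
theorem exists_package_of_live_path_re_pos (n : ℕ) (c a b : ℕ → ℂ → ℂ) (P₀ : Finset ℂ) (G₀ : ℂ → ℂ)
    (hpath : ∀ z : ℂ, 1 / 2 < z.re → c n z = c 0 z * ∏ i ∈ Finset.range n, (b i z / a i z))
    (hG₀ : DifferentiableOn ℂ G₀ {s : ℂ | 0 < s.re}) (hG₀eq : ∀ z : ℂ, 1 / 2 < z.re → G₀ z = (∏ q ∈ P₀, (z - q)) * c 0 z)
    (ha : ∀ i < n, DifferentiableOn ℂ (a i) {s : ℂ | 0 < s.re}) (hb : ∀ i < n, DifferentiableOn ℂ (b i) {s : ℂ | 0 < s.re})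
    (ha0 : ∀ i < n, ∀ z : ℂ, 0 < z.re → a i z ≠ 0) :
    ∃ G : ℂ → ℂ, DifferentiableOn ℂ G {s : ℂ | 0 < s.re} ∧ (∀ z : ℂ, 1 / 2 < z.re → G z = (∏ q ∈ P₀, (z - q)) * c n z) ∧
      ∀ z : ℂ, 0 < z.re → ∃ C r : ℝ, 0 < r ∧ ∀ s : ℂ, dist s z < r → ‖G s‖ ≤ C := by
  obtain ⟨G, hG, hGeq⟩ := exists_package_of_live_path {s : ℂ | 0 < s.re} (fun z => 1 / 2 < z.re) n c a b P₀ G₀ hpath hG₀ hG₀eq ha hb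
    (fun i hi z hz => ha0 i hi z hz)
  exact ⟨G, hG, hGeq, fun z hz => exists_local_bound_re_pos hG z hz⟩

end LivePath

/-! ## §2 The four source scalars of the U(2,2) ladder as functions of `s`: holomorphic, and live on `{0 < re}` under the region inequalities -/

section Arrows

/-- an affine function `s ↦ s + β` with `0 ≤ re β` does not vanish on `{0 < re}`. [folklore] -/
theorem add_const_ne_zero_of_re_nonneg {β : ℂ} (hβ : 0 ≤ β.re) {s : ℂ} (hs : 0 < s.re) : s + β ≠ 0 := by
  intro h
  have h1 : (s + β).re = 0 := by rw [h, Complex.zero_re]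
  rw [Complex.add_re] at h1
  linarith

/-- `s ↦ s + β` is holomorphic. [folklore] -/
theorem differentiableOn_add_const (U : Set ℂ) (β : ℂ) : DifferentiableOn ℂ (fun s : ℂ => s + β) U :=
  (differentiable_id.add_const β).differentiableOn

/-- `s ↦ r·(s + β)` is holomorphic. [folklore] -/
theorem differentiableOn_const_mul_add_const (U : Set ℂ) (r β : ℂ) : DifferentiableOn ℂ (fun s : ℂ => r * (s + β)) U :=
  ((differentiable_id.add_const β).const_mul r).differentiableOn

/-- the ratio `k∕(k+1)` is non-zero for `k ≠ 0`. [folklore] -/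
theorem natRatio_ne_zero {k : ℕ} (hk : k ≠ 0) : ((k : ℂ) / ((k : ℂ) + 1)) ≠ 0 := by
  have hk1 : ((k : ℂ) + 1) ≠ 0 := by exact_mod_cast Nat.succ_ne_zero k
  exact div_ne_zero (by exact_mod_cast hk) hk1

/-- **`+e₁` SOURCE SCALAR** `q(s) + λ₁ = s + (1 − κ∕2 + λ₁)` (★ S2-T `mOp_zero_zero_fkl`, `q = s+1−κ∕2`): LIVE on `{0 < re}` whenever `κ∕2 − 1 ≤ λ₁` (region 𝐀 row `c₁+1` and the
region-𝐃 rightward leg: `λ₁ ≥ c₁ = κ∕2 − ½`). [cite: LeeZhu1998, §5 p. 5032] -/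
theorem plusE1_scalar_ne_zero (κ l₁ : ℤ) (hl : (κ : ℝ) / 2 - 1 ≤ (l₁ : ℝ)) {s : ℂ} (hs : 0 < s.re) :
    s + (1 - (κ : ℂ) / 2 + (l₁ : ℂ)) ≠ 0 := by
  refine add_const_ne_zero_of_re_nonneg ?_ hs
  have h : (1 - (κ : ℂ) / 2 + (l₁ : ℂ)).re = 1 - (κ : ℝ) / 2 + (l₁ : ℝ) := by
    simp [Complex.add_re, Complex.sub_re, Complex.div_ofNat_re]
  rw [h]; linarith

/-- **`−e₂` SOURCE SCALAR** `p(s) − λ₂ = s + (1 + κ∕2 − λ₂)` (★ S2-T `pOp_one_one_fkl`, `p = s+1+κ∕2`): LIVE on `{0 < re}` whenever `λ₂ ≤ κ∕2 + 1` (descents from `λ₂ ≤ c₁ + 1 = κ∕2 + ½`).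
[cite: LeeZhu1998, §5 p. 5032] -/
theorem minusE2_scalar_ne_zero (κ l₂ : ℤ) (hl : (l₂ : ℝ) ≤ (κ : ℝ) / 2 + 1) {s : ℂ} (hs : 0 < s.re) :
    s + (1 + (κ : ℂ) / 2 - (l₂ : ℂ)) ≠ 0 := by
  refine add_const_ne_zero_of_re_nonneg ?_ hs
  have h : (1 + (κ : ℂ) / 2 - (l₂ : ℂ)).re = 1 + (κ : ℝ) / 2 - (l₂ : ℝ) := by
    simp [Complex.add_re, Complex.sub_re, Complex.div_ofNat_re]
  rw [h]; linarith

/-- **`+e₂` SOURCE SCALAR** `(k∕(k+1))·(q(s) + λ₂ − 1) = (k∕(k+1))·(s + (λ₂ − κ∕2))` (★ S2-T `succ_smul_mOp_one_one_fkl`, source `(k+1, ·)` relabelled `k ≥ 1`): LIVE on `{0 < re}`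
whenever `k ≠ 0` and `κ∕2 ≤ λ₂` (region-𝐀 ascents from `λ₂ ≥ c₁ + 1`). [cite: LeeZhu1998, §5 p. 5032] -/
theorem plusE2_scalar_ne_zero (κ l₂ : ℤ) {k : ℕ} (hk : k ≠ 0) (hl : (κ : ℝ) / 2 ≤ (l₂ : ℝ)) {s : ℂ} (hs : 0 < s.re) :
    ((k : ℂ) / ((k : ℂ) + 1)) * (s + ((l₂ : ℂ) - (κ : ℂ) / 2)) ≠ 0 := by
  refine mul_ne_zero (natRatio_ne_zero hk) (add_const_ne_zero_of_re_nonneg ?_ hs)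
  have h : ((l₂ : ℂ) - (κ : ℂ) / 2).re = (l₂ : ℝ) - (κ : ℝ) / 2 := by
    simp [Complex.sub_re, Complex.div_ofNat_re]
  rw [h]; linarith

/-- **`−e₁` SOURCE SCALAR** `(k∕(k+1))·(p(s) − λ₁ − 1) = (k∕(k+1))·(s + (κ∕2 − λ₁))` (★ S2-T `succ_smul_pOp_zero_zero_fkl`): LIVE on `{0 < re}` whenever `k ≠ 0` and `λ₁ ≤ κ∕2`
(region-𝐃 leftward legs, `λ₁ ≤ c₁ = κ∕2 − ½`). [cite: LeeZhu1998, §5 p. 5032] -/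
theorem minusE1_scalar_ne_zero (κ l₁ : ℤ) {k : ℕ} (hk : k ≠ 0) (hl : (l₁ : ℝ) ≤ (κ : ℝ) / 2) {s : ℂ} (hs : 0 < s.re) :
    ((k : ℂ) / ((k : ℂ) + 1)) * (s + ((κ : ℂ) / 2 - (l₁ : ℂ))) ≠ 0 := by
  refine mul_ne_zero (natRatio_ne_zero hk) (add_const_ne_zero_of_re_nonneg ?_ hs)
  have h : ((κ : ℂ) / 2 - (l₁ : ℂ)).re = (κ : ℝ) / 2 - (l₁ : ℝ) := by
    simp [Complex.sub_re, Complex.div_ofNat_re]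
  rw [h]; linarith

end Arrows

/-! ## §3 The package along an S2-C region path: `P = P₀` -/

section RegionPath

/-- **THE FOUR ADMISSIBLE ARROW SHAPES** of an S2-C path at weight `κ`: the `i`-th source scalar is one of `+e₁` at `λ₁ ≥ κ∕2 − 1`, `−e₂` at `λ₂ ≤ κ∕2 + 1`, `+e₂` at `λ₂ ≥ κ∕2` with `k ≥ 1`,
`−e₁` at `λ₁ ≤ κ∕2` with `k ≥ 1` (as functions of `s`).  Each such scalar is holomorphic and live on `{0 < re}`. [cite: LeeZhu1998, §5 (5.3), Prop. 5.4] -/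
theorem admissible_scalar_live (κ : ℤ) (a : ℂ → ℂ)
    (h : (∃ l₁ : ℤ, (κ : ℝ) / 2 - 1 ≤ (l₁ : ℝ) ∧ a = fun s => s + (1 - (κ : ℂ) / 2 + (l₁ : ℂ))) ∨
      (∃ l₂ : ℤ, (l₂ : ℝ) ≤ (κ : ℝ) / 2 + 1 ∧ a = fun s => s + (1 + (κ : ℂ) / 2 - (l₂ : ℂ))) ∨
      (∃ (k : ℕ) (l₂ : ℤ), k ≠ 0 ∧ (κ : ℝ) / 2 ≤ (l₂ : ℝ) ∧ a = fun s => ((k : ℂ) / ((k : ℂ) + 1)) * (s + ((l₂ : ℂ) - (κ : ℂ) / 2))) ∨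
      (∃ (k : ℕ) (l₁ : ℤ), k ≠ 0 ∧ (l₁ : ℝ) ≤ (κ : ℝ) / 2 ∧ a = fun s => ((k : ℂ) / ((k : ℂ) + 1)) * (s + ((κ : ℂ) / 2 - (l₁ : ℂ))))) :
    DifferentiableOn ℂ a {s : ℂ | 0 < s.re} ∧ ∀ z : ℂ, 0 < z.re → a z ≠ 0 := by
  rcases h with ⟨l₁, hl, rfl⟩ | ⟨l₂, hl, rfl⟩ | ⟨k, l₂, hk, hl, rfl⟩ | ⟨k, l₁, hk, hl, rfl⟩
  · exact ⟨differentiableOn_add_const _ _, fun z hz => plusE1_scalar_ne_zero κ l₁ hl hz⟩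
  · exact ⟨differentiableOn_add_const _ _, fun z hz => minusE2_scalar_ne_zero κ l₂ hl hz⟩
  · exact ⟨differentiableOn_const_mul_add_const _ _ _, fun z hz => plusE2_scalar_ne_zero κ l₂ hk hl hz⟩
  · exact ⟨differentiableOn_const_mul_add_const _ _ _, fun z hz => minusE1_scalar_ne_zero κ l₁ hk hl hz⟩

/-- **σ20 ALONG AN S2-C REGION PATH — NO NEW POLES.**  Weight `κ`; a path of `n` arrows with source scalars `a_i` of the four admissible shapes (`hadm`), target scalars `b_i` holomorphic on
`{0 < re}` (affine at `−s`: entire), the rung relation `c_n = c₀·∏ b_i∕a_i` on `{½ < re}` (★ (H1)∕(H2-alg) with the (H2-an) swap binders — BY VALUE), and the anchor's package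
`(P₀, G₀)` (★ `K2LiuArchIntertwiningScalarPole` ∕ (L2): `P₀ = ∅` odd class, `{½}` even class — BY VALUE) ⇒ the end type's package has the SAME pole set:
`∃ G` holomorphic on `{0 < re}` with `G = ∏_{q∈P₀}(s−q)·c_n` on `{½ < re}` and σ20's local growth letter. [cite: LeeZhu1998, §5 (5.3), Prop. 5.4] [cite: Shimura1997, §16.4] -/
theorem exists_package_of_regionPath (κ : ℤ) (n : ℕ) (c a b : ℕ → ℂ → ℂ) (P₀ : Finset ℂ) (G₀ : ℂ → ℂ)
    (hadm : ∀ i < n,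
      (∃ l₁ : ℤ, (κ : ℝ) / 2 - 1 ≤ (l₁ : ℝ) ∧ a i = fun s => s + (1 - (κ : ℂ) / 2 + (l₁ : ℂ))) ∨
      (∃ l₂ : ℤ, (l₂ : ℝ) ≤ (κ : ℝ) / 2 + 1 ∧ a i = fun s => s + (1 + (κ : ℂ) / 2 - (l₂ : ℂ))) ∨
      (∃ (k : ℕ) (l₂ : ℤ), k ≠ 0 ∧ (κ : ℝ) / 2 ≤ (l₂ : ℝ) ∧ a i = fun s => ((k : ℂ) / ((k : ℂ) + 1)) * (s + ((l₂ : ℂ) - (κ : ℂ) / 2))) ∨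
      (∃ (k : ℕ) (l₁ : ℤ), k ≠ 0 ∧ (l₁ : ℝ) ≤ (κ : ℝ) / 2 ∧ a i = fun s => ((k : ℂ) / ((k : ℂ) + 1)) * (s + ((κ : ℂ) / 2 - (l₁ : ℂ)))))
    (hb : ∀ i < n, DifferentiableOn ℂ (b i) {s : ℂ | 0 < s.re})
    (hpath : ∀ z : ℂ, 1 / 2 < z.re → c n z = c 0 z * ∏ i ∈ Finset.range n, (b i z / a i z))
    (hG₀ : DifferentiableOn ℂ G₀ {s : ℂ | 0 < s.re}) (hG₀eq : ∀ z : ℂ, 1 / 2 < z.re → G₀ z = (∏ q ∈ P₀, (z - q)) * c 0 z) :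
    ∃ G : ℂ → ℂ, DifferentiableOn ℂ G {s : ℂ | 0 < s.re} ∧ (∀ z : ℂ, 1 / 2 < z.re → G z = (∏ q ∈ P₀, (z - q)) * c n z) ∧
      ∀ z : ℂ, 0 < z.re → ∃ C r : ℝ, 0 < r ∧ ∀ s : ℂ, dist s z < r → ‖G s‖ ≤ C :=
  exists_package_of_live_path_re_pos n c a b P₀ G₀ hpath hG₀ hG₀eq (fun i hi => (admissible_scalar_live κ (a i) (hadm i hi)).1) hb
    (fun i hi z hz => (admissible_scalar_live κ (a i) (hadm i hi)).2 z hz)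

end RegionPath

end Summit.HodgeConjecture.HodgeConjecture.Cruxes.HLiu418.K2LiuArchLadderMeromorphicPackage

end
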